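import Literature.NumberTheory.Transcendental.NesterenkoEliminationK
import Mathlib.Analysis.Normed.Field.Basic
import HarnessLib

/-!
# The local invariants `ϰ(F)`, `|I(ω̄)|`, `‖P‖_ω̄`, `‖φ̄ − ψ̄‖`, `ρ` of LNM 1752 Ch. 3 §4 over an ARBITRARY valued extension `L ⊇ K`

`Literature/NumberTheory/Transcendental/NesterenkoEliminationLocalK.lean` — definitions (generic
field), with bridges to the case `K = ℚ ⊂ L = ℂ` of `NesterenkoElimination.lean`.

Ch. 3 §4 of the book (p. 39) fixes ONE absolute value `| | = | |_w` of the base field `K`, lets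
`𝒦` be the completion of the algebraic closure of the completion `K_w`, and defines for points
`ω̄ ∈ 𝒦^{m+1}` the quantities `|ω̄| = max |ωⱼ|`, `ϰ(E)` (substitute the generic skew products
`S⁽ⁱ⁾ω̄` for the blocks `uᵢ`), `|I(ω̄)| = |ϰ(F)| · |F|⁻¹ · |ω̄|^{−r deg I}` (Definition 4.6),
`‖P‖_ω̄ = |P(ω̄)| |P|⁻¹ |ω̄|^{−deg P}`, the projective distance `‖φ̄ − ψ̄‖` and
`ρ = min_{β̄ ∈ V(𝔭)} ‖ω̄ − β̄‖` ((19)–(20), p. 40). The tree has them for `K = ℚ`, `𝒦 = ℂ`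
(`Nesterenko.kappa`, `iabs`, `normAt`, `projDist`, `projZeros`, `rho`). Chapter 10 uses them for
`K = ℂ(z)` with `|α| = e^{−ord_{z=0} α}` (Ch. 3 Example 1; Ch. 10 §2, p. 153), i.e. a
NON-archimedean `w`, and a proof treating `z` as a projective coordinate uses `K = ℂ` inside a
`z`-adically valued field. This file therefore re-issues the definitions for

* any field `K` (coefficients of the ideals and of the associated form, `NesterenkoK.chowForm`,
  `NesterenkoK.ideg` of `NesterenkoEliminationK.lean`), and
* any normed field `L` that is a `K`-algebra (the rôle of `𝒦`; `| |_w` on `K` is the restriction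
  of the norm of `L` along `algebraMap K L`), points `ω̄ : Fin (m + 1) → L` with the sup norm:

`NesterenkoK.skewEntry`, `NesterenkoK.kappa` (any commutative `K`-algebra `A` in place of `L`),
`NesterenkoK.fieldNorm F = |F|_w` (`maxNorm` of `F` mapped to `L`), `NesterenkoK.iabs`,
`NesterenkoK.normAt`, `NesterenkoK.projDist`, `NesterenkoK.projZeros`, `NesterenkoK.rho`, each
literally the `ℚ/ℂ` formula with `ℚ ↦ K`, `ℂ ↦ L` (bridges `Nesterenko.kappa_eq`, `projDist_eq`,
`projZeros_eq`, `rho_eq`, `normAt_eq`, `iabs_eq` for `K = ℚ`, `L = ℂ`). Heights (Def. 4.2, the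
GLOBAL datum `𝓜`) are not treated here.

## References

* [NesterenkoPhilippon2001] Yu. V. Nesterenko, P. Philippon (eds.), *Introduction to Algebraic
  Independence Theory*, LNM 1752, Springer 2001, Ch. 3 §4: Def. 4.1 (p. 37), Def. 4.6 and
  properties 1)–2) (p. 39), (19)–(20) (p. 40), Example 1 (p. 37); Ch. 10 §2 (p. 153).
-/

noncomputable section

open MvPolynomial

namespace Literature.NumberTheory.Transcendental

namespace NesterenkoK

variable {K : Type*} [Field K] {m : ℕ}

/-! ### `ϰ(F)` over any commutative `K`-algebra -/

section Kappa

variable {A : Type*} [CommRing A]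

/-- The entry `s⁽ⁱ⁾_{jk}` of the generic skew-symmetric matrix `S⁽ⁱ⁾` with entries in
`A[s⁽ⁱ⁾_{jk} : j < k]`: the variable `s⁽ⁱ⁾_{jk}` for `j < k`, `−s⁽ⁱ⁾_{kj}` for `k < j`, `0` on the
diagonal. For `A = ℂ` this is `Nesterenko.skewEntry` (`Nesterenko.skewEntry_eq`).
[cite: NesterenkoPhilippon2001, Ch. 3 Def. 4.6 (p. 39)] -/
def skewEntry {r : ℕ} (i : Fin r) (j k : Fin (m + 1)) :
    MvPolynomial (Fin r × Nesterenko.SkewIdx m) A :=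
  if h : j < k then X (i, ⟨(j, k), h⟩) else if h' : k < j then -X (i, ⟨(k, j), h'⟩) else 0

/-- `S⁽ⁱ⁾` is skew-symmetric. [folklore] -/
theorem skewEntry_swap {r : ℕ} (i : Fin r) (j k : Fin (m + 1)) :
    (skewEntry i k j : MvPolynomial (Fin r × Nesterenko.SkewIdx m) A) = -skewEntry i j k := by
  unfold skewEntry
  rcases lt_trichotomy j k with h | rfl | h
  · rw [dif_neg (not_lt.mpr h.le), dif_pos h, dif_pos h]
  · simp
  · rw [dif_pos h, dif_neg (not_lt.mpr h.le), dif_pos h, neg_neg]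

/-- `s⁽ⁱ⁾_{jj} = 0`. [folklore] -/
@[simp] theorem skewEntry_self {r : ℕ} (i : Fin r) (j : Fin (m + 1)) :
    (skewEntry i j j : MvPolynomial (Fin r × Nesterenko.SkewIdx m) A) = 0 := by
  simp [skewEntry]

variable [Algebra K A]

/-- **`ϰ(F)`**: the polynomial in the `s⁽ⁱ⁾_{jk}` with coefficients in the `K`-algebra `A`
obtained from `F ∈ K[u₁, …, u_r]` by substituting the vector `S⁽ⁱ⁾ω̄` (`(S⁽ⁱ⁾ω̄)ⱼ = ∑ₖ s⁽ⁱ⁾_{jk} ωₖ`)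
for the block `uᵢ`, `ω̄ ∈ A^{m+1}`. For `K = ℚ`, `A = ℂ` this is `Nesterenko.kappa`
(`Nesterenko.kappa_eq`). [cite: NesterenkoPhilippon2001, Ch. 3 Def. 4.6 (p. 39)] -/
def kappa {r : ℕ} (ω : Fin (m + 1) → A) (F : MvPolynomial (Fin r × Fin (m + 1)) K) :
    MvPolynomial (Fin r × Nesterenko.SkewIdx m) A :=
  aeval (fun ij : Fin r × Fin (m + 1) => ∑ k : Fin (m + 1), skewEntry ij.1 ij.2 k * C (ω k)) F

/-- `ϰ` on a variable: `ϰ(u_{ij}) = (S⁽ⁱ⁾ω̄)ⱼ`. [cite: NesterenkoPhilippon2001, Ch. 3 Def. 4.6 (p. 39)] -/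
theorem kappa_X {r : ℕ} (ω : Fin (m + 1) → A) (ij : Fin r × Fin (m + 1)) :
    kappa ω (X ij : MvPolynomial (Fin r × Fin (m + 1)) K) =
      ∑ k : Fin (m + 1), skewEntry ij.1 ij.2 k * C (ω k) := by
  simp [kappa]

/-- `ϰ` is a ring homomorphism (it is an algebra evaluation): `ϰ(FG) = ϰ(F)ϰ(G)`. [folklore] -/
theorem kappa_mul {r : ℕ} (ω : Fin (m + 1) → A) (F G : MvPolynomial (Fin r × Fin (m + 1)) K) :
    kappa ω (F * G) = kappa ω F * kappa ω G :=
  map_mul _ _ _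

/-- `ϰ(Fⁿ) = ϰ(F)ⁿ`. [folklore] -/
theorem kappa_pow {r : ℕ} (ω : Fin (m + 1) → A) (F : MvPolynomial (Fin r × Fin (m + 1)) K) (n : ℕ) :
    kappa ω (F ^ n) = kappa ω F ^ n :=
  map_pow _ _ _

/-- `ϰ(∏ Fᵢ) = ∏ ϰ(Fᵢ)`. [folklore] -/
theorem kappa_prod {r : ℕ} {ι : Type*} (ω : Fin (m + 1) → A) (s : Finset ι)
    (F : ι → MvPolynomial (Fin r × Fin (m + 1)) K) :
    kappa ω (∏ i ∈ s, F i) = ∏ i ∈ s, kappa ω (F i) :=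
  map_prod _ _ _

/-- `ϰ(c) = c` for constants. [folklore] -/
theorem kappa_C {r : ℕ} (ω : Fin (m + 1) → A) (c : K) :
    kappa ω (C c : MvPolynomial (Fin r × Fin (m + 1)) K) = C (algebraMap K A c) := by
  rw [kappa, aeval_C, MvPolynomial.algebraMap_apply]

end Kappa

/-! ### `|F|_w`, `|I(ω̄)|`, `‖P‖_ω̄` over a normed extension `L` -/

section Normed

variable {L : Type*} [NormedField L] [Algebra K L]

variable (L) in
/-- `|F|_w` for `F` with coefficients in `K`: Definition 4.1 for the absolute value of `K` induced
by the norm of `L` (`max_γ |a_γ|_w`, computed on `F` mapped to `L`).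
[cite: NesterenkoPhilippon2001, Ch. 3 Def. 4.1 (p. 37)] -/
def fieldNorm {σ : Type*} (F : MvPolynomial σ K) : ℝ :=
  Nesterenko.maxNorm (map (algebraMap K L) F)

/-- `|F|_w ≥ 0`. [folklore] -/
theorem fieldNorm_nonneg {σ : Type*} (F : MvPolynomial σ K) : 0 ≤ fieldNorm L F :=
  Nesterenko.maxNorm_nonneg _

/-- `|0|_w = 0`. [folklore] -/
@[simp] theorem fieldNorm_zero {σ : Type*} : fieldNorm L (0 : MvPolynomial σ K) = 0 := by
  simp [fieldNorm]

/-- **Definition 4.6 over `L`**: `|I(ω̄)| = |ϰ(F)| · |F|_w⁻¹ · |ω̄|^{−r deg I}`, `F` the associated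
form of index `r`, `|·|` the maximum of the norms of the coefficients, `|ω̄| = max ‖ωⱼ‖` (the book's
exponent `−r · deg H` is a typo for `−r · deg I`). For `K = ℚ`, `L = ℂ` this is `Nesterenko.iabs`
(`Nesterenko.iabs_eq`). [cite: NesterenkoPhilippon2001, Ch. 3 Def. 4.6 (p. 39)] -/
def iabs (I : Ideal (MvPolynomial (Fin (m + 1)) K)) (r : ℕ) (ω : Fin (m + 1) → L) : ℝ :=
  Nesterenko.maxNorm (kappa ω (chowForm I r)) / (fieldNorm L (chowForm I r) * ‖ω‖ ^ (r * ideg I r))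

/-- `|I(ω̄)| ≥ 0`. [folklore] -/
theorem iabs_nonneg (I : Ideal (MvPolynomial (Fin (m + 1)) K)) (r : ℕ) (ω : Fin (m + 1) → L) :
    0 ≤ iabs I r ω :=
  div_nonneg (Nesterenko.maxNorm_nonneg _)
    (mul_nonneg (fieldNorm_nonneg _) (pow_nonneg (norm_nonneg _) _))

/-- The normalised value `‖P‖_ω̄ = |P(ω̄)| · |P|_w⁻¹ · |ω̄|^{−deg P}` of a homogeneous `P ∈ K[x̲]` at
`ω̄ ∈ L^{m+1}` (`deg P` = total degree). For `K = ℚ`, `L = ℂ` this is `Nesterenko.normAt`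
(`Nesterenko.normAt_eq`). [cite: NesterenkoPhilippon2001, Ch. 3 §4 (p. 40)] -/
def normAt (ω : Fin (m + 1) → L) (P : MvPolynomial (Fin (m + 1)) K) : ℝ :=
  ‖aeval ω P‖ / (fieldNorm L P * ‖ω‖ ^ P.totalDegree)

/-- `‖P‖_ω̄ ≥ 0`. [folklore] -/
theorem normAt_nonneg (ω : Fin (m + 1) → L) (P : MvPolynomial (Fin (m + 1)) K) : 0 ≤ normAt ω P :=
  div_nonneg (norm_nonneg _) (mul_nonneg (fieldNorm_nonneg _) (pow_nonneg (norm_nonneg _) _))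

/-- The projective distance `‖φ̄ − ψ̄‖ = max_{0 ≤ i < j ≤ m} |φᵢψⱼ − φⱼψᵢ| · |φ̄|⁻¹ · |ψ̄|⁻¹` on
`L^{m+1}`. For `L = ℂ` this is `Nesterenko.projDist` (`Nesterenko.projDist_eq`).
[cite: NesterenkoPhilippon2001, Ch. 3 §4 (19) (p. 40)] -/
def projDist (φ ψ : Fin (m + 1) → L) : ℝ :=
  ((Finset.univ.sup fun p : Nesterenko.SkewIdx m => ‖φ p.1.1 * ψ p.1.2 - φ p.1.2 * ψ p.1.1‖₊ :
      NNReal) : ℝ) / (‖φ‖ * ‖ψ‖)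

/-- `‖φ̄ − ψ̄‖ ≥ 0`. [folklore] -/
theorem projDist_nonneg (φ ψ : Fin (m + 1) → L) : 0 ≤ projDist φ ψ :=
  div_nonneg (NNReal.coe_nonneg _) (mul_nonneg (norm_nonneg _) (norm_nonneg _))

/-- `‖φ̄ − φ̄‖ = 0`. [folklore] -/
@[simp] theorem projDist_self (φ : Fin (m + 1) → L) : projDist φ φ = 0 := by
  simp [projDist, mul_comm]

/-- The projective zeros `V_L(I)` of an ideal `I ⊂ K[x̲]`: non-zero vectors of `L^{m+1}` killed by
`I`. For `K = ℚ`, `L = ℂ` this is `Nesterenko.projZeros` (`Nesterenko.projZeros_eq`).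
[cite: NesterenkoPhilippon2001, Ch. 3 §4 (20) (p. 40)] -/
def projZeros (I : Ideal (MvPolynomial (Fin (m + 1)) K)) : Set (Fin (m + 1) → L) :=
  {β | β ≠ 0 ∧ ∀ P ∈ I, aeval β P = 0}

/-- Membership in `V_L(I)`, by definition. [folklore] -/
theorem mem_projZeros_iff (I : Ideal (MvPolynomial (Fin (m + 1)) K)) (β : Fin (m + 1) → L) :
    β ∈ projZeros I ↔ β ≠ 0 ∧ ∀ P ∈ I, aeval β P = 0 :=
  Iff.rfl

/-- `V_L` is antitone in the ideal. [folklore] -/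
theorem projZeros_antitone {I J : Ideal (MvPolynomial (Fin (m + 1)) K)} (h : I ≤ J) :
    (projZeros J : Set (Fin (m + 1) → L)) ⊆ projZeros I :=
  fun _ ⟨hβ0, hβ⟩ => ⟨hβ0, fun P hP => hβ P (h hP)⟩

/-- **(20) over `L`**: `ρ(ω̄) = inf_{β̄ ∈ V_L(I)} ‖ω̄ − β̄‖` (`0` if `V_L(I) = ∅`). For `K = ℚ`,
`L = ℂ` this is `Nesterenko.rho` (`Nesterenko.rho_eq`). [cite: NesterenkoPhilippon2001, Ch. 3 §4 (20) (p. 40)] -/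
def rho (ω : Fin (m + 1) → L) (I : Ideal (MvPolynomial (Fin (m + 1)) K)) : ℝ :=
  sInf (projDist ω '' projZeros I)

/-- `ρ ≥ 0`. [folklore] -/
theorem rho_nonneg (ω : Fin (m + 1) → L) (I : Ideal (MvPolynomial (Fin (m + 1)) K)) :
    0 ≤ rho ω I := by
  refine Real.sInf_nonneg ?_
  rintro _ ⟨β, -, rfl⟩
  exact projDist_nonneg _ _

/-- `ρ(ω̄) ≤ ‖ω̄ − β̄‖` for every zero `β̄ ∈ V_L(I)`. [folklore] -/
theorem rho_le_projDist (ω : Fin (m + 1) → L) {I : Ideal (MvPolynomial (Fin (m + 1)) K)}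
    {β : Fin (m + 1) → L} (hβ : β ∈ projZeros I) : rho ω I ≤ projDist ω β :=
  csInf_le ⟨0, by rintro _ ⟨β', -, rfl⟩; exact projDist_nonneg _ _⟩ ⟨β, hβ, rfl⟩

/-- If `ω̄` itself is a zero of `I` then `ρ(ω̄) = 0`. [folklore] -/
theorem rho_eq_zero_of_mem (ω : Fin (m + 1) → L) {I : Ideal (MvPolynomial (Fin (m + 1)) K)}
    (hω : ω ∈ projZeros I) : rho ω I = 0 :=
  le_antisymm (by simpa using rho_le_projDist ω hω) (rho_nonneg ω I)

end Normed

end NesterenkoK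

/-! ### The case `K = ℚ`, `L = ℂ`: agreement with `NesterenkoElimination.lean` -/

namespace Nesterenko

variable {m : ℕ}

/-- `Nesterenko.skewEntry` is `NesterenkoK.skewEntry` over `ℂ`. [folklore] -/
theorem skewEntry_eq {r : ℕ} (i : Fin r) (j k : Fin (m + 1)) :
    skewEntry i j k = (NesterenkoK.skewEntry i j k : RS r m) := rfl

/-- `Nesterenko.kappa` is the case `K = ℚ`, `A = ℂ` of `NesterenkoK.kappa`. [folklore] -/
theorem kappa_eq {r : ℕ} (ω : Fin (m + 1) → ℂ) (F : RU r m) : kappa ω F = NesterenkoK.kappa ω F :=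
  rfl

/-- `Nesterenko.projDist` is `NesterenkoK.projDist` over `ℂ`. [folklore] -/
theorem projDist_eq (φ ψ : Fin (m + 1) → ℂ) : projDist φ ψ = NesterenkoK.projDist φ ψ := rfl

/-- `Nesterenko.projZeros` is the case `K = ℚ`, `L = ℂ` of `NesterenkoK.projZeros`. [folklore] -/
theorem projZeros_eq (I : Ideal (Rx m)) : projZeros I = (NesterenkoK.projZeros I : Set (Fin (m + 1) → ℂ)) :=
  rfl

/-- `Nesterenko.rho` is the case `K = ℚ`, `L = ℂ` of `NesterenkoK.rho`. [folklore] -/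
theorem rho_eq (ω : Fin (m + 1) → ℂ) (I : Ideal (Rx m)) : rho ω I = NesterenkoK.rho ω I := rfl

/-- Over `ℚ ⊂ ℂ` the field norm of `NesterenkoK` is the `maxNorm` of `NesterenkoElimination.lean`
(`|a|_ℂ = |a|` for `a ∈ ℚ`). [folklore] -/
theorem maxNorm_eq_fieldNorm {σ : Type*} (F : MvPolynomial σ ℚ) :
    maxNorm F = NesterenkoK.fieldNorm ℂ F := by
  unfold NesterenkoK.fieldNorm maxNorm
  rw [support_map_of_injective _ (algebraMap ℚ ℂ).injective]
  congr 1
  refine Finset.sup_congr rfl fun γ _ => ?_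
  rw [coeff_map]
  ext
  simp

/-- `Nesterenko.normAt` is the case `K = ℚ`, `L = ℂ` of `NesterenkoK.normAt`. [folklore] -/
theorem normAt_eq (ω : Fin (m + 1) → ℂ) (P : Rx m) : normAt ω P = NesterenkoK.normAt ω P := by
  rw [normAt, NesterenkoK.normAt, maxNorm_eq_fieldNorm]

/-- `Nesterenko.iabs` is the case `K = ℚ`, `L = ℂ` of `NesterenkoK.iabs`. [folklore] -/
theorem iabs_eq (I : Ideal (Rx m)) (r : ℕ) (ω : Fin (m + 1) → ℂ) : iabs I r ω = NesterenkoK.iabs I r ω := by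
  rw [iabs, NesterenkoK.iabs, maxNorm_eq_fieldNorm, chowForm_eq, ideg_eq, kappa_eq]

end Nesterenko

end Literature.NumberTheory.Transcendental

end
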